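import Summits.QuantumFields.YangMills.Theses.LangevinControlUV
import Summits.QuantumFields.YangMills.Theorems.TunedSequenceExists.Negative.Freezing
import Literature.MathematicalPhysics.QuantumFieldTheory.LatticeGaugeDobrushinPoincare
import Literature.MathematicalPhysics.QuantumFieldTheory.LatticeGaugeStaticPotentialProofs

/-!
# `FemtoCurvatureTwoPoint` — freezing of plaquette covariances on a fixed torus (`β → ∞`)

Negative-side support for crux `Summit.QuantumFields.YangMills.Theses.LangevinControlUV.
FemtoCurvatureTwoPoint` (item stmt-QuantumFields-9363; cdisprove gen 1, importable extract of
`§ Basic` / `§ Freezing` of the crux workfile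
`Summits/QuantumFields/YangMills/Cruxes/FemtoCurvatureTwoPoint/Disproof.lean`).

For EVERY compact (second-countable) group `G` and EVERY continuous unitary matrix representation
`ρ` (faithful or not), on a FIXED torus `(ℤ/L)⁴`:

* `plaquetteField_eq_zero_of_flat` — on flat configurations (zero Wilson action) every plaquette
  field `P_x^{ij} = N - Re tr ρ(U_p)` vanishes, in every orientation (also `i = j`, `i > j`;
  tree lemmas `plaquetteHolonomy_swap`, `plaquetteHolonomy_self`, `re_trace_map_inv`);
* `tendsto_wilsonExpectation_plaquetteField`, `tendsto_plaquetteCov` — `⟨P_x^{ij}⟩_{L,β} → 0` and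
  `Cov_{L,β}(P_x^{ij}, P_y^{i'j'}) → 0` as `β → ∞` (Laplace concentration of Wilson's measure on
  flat configurations, tree lemma `TunedSequenceExists.Negative.Freezing.tendsto_integral_wilsonMeasure`).

Consequences for the crux (files `Negative.ForcedDividend`, `Negative.UpperOnly`): every torus is
eventually femto, so the crux's lower bound `c Γ(n a(β)) ≤ n⁸ Cov_{8n,β}` forces `Γ(n a(β)) → 0`
(the asymptotic-freedom dividend is not optional; constant shape functions are impossible), while
every OTHER clause of the crux is satisfiable by freezing alone.
-/

noncomputable section

open scoped Matrix
open Filter Topology MeasureTheory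
open Literature.MathematicalPhysics.QuantumFieldTheory Literature.MathematicalPhysics.QuantumLattice
open Summit.QuantumFields.YangMills.Theorems.TunedSequenceExists.Negative.Freezing
  (tendsto_integral_wilsonMeasure re_trace_le_of_mem_unitaryGroup
    re_trace_eq_of_wilsonAction_eq_zero continuous_plaquetteHolonomy secondCountable_of_latticeRep)

namespace Summit.QuantumFields.YangMills.Theorems.FemtoCurvatureTwoPoint.Negative.PlaquetteFreezing

variable {G : Type} [Group G] [TopologicalSpace G] [IsTopologicalGroup G] [CompactSpace G]
  [MeasurableSpace G] [BorelSpace G] {N : ℕ} (ρ : G →* Matrix (Fin N) (Fin N) ℂ)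

omit [TopologicalSpace G] [IsTopologicalGroup G] [CompactSpace G] [MeasurableSpace G]
  [BorelSpace G] in
/-- **On flat configurations every plaquette field vanishes**, in every orientation:
`S(U) = 0 ⇒ N - Re tr ρ(U_{p(x;i,j)}) = 0` for all `x, i, j` (unitary `ρ`). -/
theorem plaquetteField_eq_zero_of_flat (hρu : ∀ g, ρ g ∈ Matrix.unitaryGroup (Fin N) ℂ)
    {L : ℕ} [NeZero L] {U : GaugeConfig 4 L G} (hU : wilsonAction ρ U = 0) (x : Site 4 L)
    (i j : Fin 4) : (N : ℝ) - (ρ (plaquetteHolonomy U x i j)).trace.re = 0 := by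
  have hρN : ∀ g, (ρ g).trace.re ≤ N := fun g => re_trace_le_of_mem_unitaryGroup (hρu g)
  rcases lt_trichotomy i j with hij | rfl | hji
  · rw [re_trace_eq_of_wilsonAction_eq_zero ρ hρN hU x i j hij, sub_self]
  · simp [plaquetteHolonomy_self, Matrix.trace_one]
  · rw [plaquetteHolonomy_swap U x j i, re_trace_map_inv ρ hρu,
      re_trace_eq_of_wilsonAction_eq_zero ρ hρN hU x j i hji, sub_self]

omit [CompactSpace G] [MeasurableSpace G] [BorelSpace G] in
/-- The plaquette field `U ↦ N - Re tr ρ(U_{p(x;i,j)})` is continuous (continuous `ρ`). -/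
theorem continuous_plaquetteField (hρ : Continuous ρ) {L : ℕ} (x : Site 4 L) (i j : Fin 4) :
    Continuous fun U : GaugeConfig 4 L G => (N : ℝ) - (ρ (plaquetteHolonomy U x i j)).trace.re :=
  continuous_const.sub ((continuous_trace_re ρ hρ).comp (continuous_plaquetteHolonomy x i j))

variable [SecondCountableTopology G]

/-- **`⟨P_x^{ij}⟩_{L,β} → 0` as `β → ∞`** on a fixed torus, for every compact `G` and continuous
unitary `ρ`. -/
theorem tendsto_wilsonExpectation_plaquetteField (hρ : Continuous ρ)
    (hρu : ∀ g, ρ g ∈ Matrix.unitaryGroup (Fin N) ℂ) {L : ℕ} [NeZero L] (x : Site 4 L)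
    (i j : Fin 4) :
    Tendsto (fun β : ℝ => wilsonExpectation (d := 4) (L := L) ρ β
      fun U => (N : ℝ) - (ρ (plaquetteHolonomy U x i j)).trace.re) atTop (𝓝 0) :=
  tendsto_integral_wilsonMeasure ρ hρ (fun g => re_trace_le_of_mem_unitaryGroup (hρu g))
    (continuous_plaquetteField ρ hρ x i j) fun _ hU => plaquetteField_eq_zero_of_flat ρ hρu hU x i j

/-- **Freezing of plaquette covariances.** On a fixed torus `(ℤ/L)⁴`, for every compact `G` and
continuous unitary `ρ`: `Cov_{L,β}(P_x^{ij}, P_y^{i'j'}) → 0` as `β → ∞`, where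
`P_x^{ij} = N - Re tr ρ(U_{p(x;i,j)})` and `Cov(F, F') = ⟨F F'⟩ - ⟨F⟩⟨F'⟩` under Wilson's measure. -/
theorem tendsto_plaquetteCov (hρ : Continuous ρ) (hρu : ∀ g, ρ g ∈ Matrix.unitaryGroup (Fin N) ℂ)
    {L : ℕ} [NeZero L] (x y : Site 4 L) (i j i' j' : Fin 4) :
    Tendsto (fun β : ℝ =>
      wilsonExpectation (d := 4) (L := L) ρ β (fun U =>
          ((N : ℝ) - (ρ (plaquetteHolonomy U x i j)).trace.re) *
            ((N : ℝ) - (ρ (plaquetteHolonomy U y i' j')).trace.re)) -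
        wilsonExpectation (d := 4) (L := L) ρ β
            (fun U => (N : ℝ) - (ρ (plaquetteHolonomy U x i j)).trace.re) *
          wilsonExpectation (d := 4) (L := L) ρ β
            (fun U => (N : ℝ) - (ρ (plaquetteHolonomy U y i' j')).trace.re)) atTop (𝓝 0) := by
  have h1 := tendsto_integral_wilsonMeasure ρ hρ (fun g => re_trace_le_of_mem_unitaryGroup (hρu g))
    ((continuous_plaquetteField ρ hρ x i j).mul (continuous_plaquetteField ρ hρ y i' j')) (c := 0)
    fun U hU => by simp [plaquetteField_eq_zero_of_flat ρ hρu hU]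
  have h2 := tendsto_wilsonExpectation_plaquetteField ρ hρ hρu x i j
  have h3 := tendsto_wilsonExpectation_plaquetteField ρ hρ hρu y i' j'
  have h := h1.sub (h2.mul h3)
  simpa [wilsonExpectation] using h

omit [SecondCountableTopology G] in
/-- The same for a faithful lattice representation `r` (second countability is automatic). -/
theorem tendsto_plaquetteCov_rep (r : LatticeRep G) {L : ℕ} [NeZero L] (x y : Site 4 L)
    (i j i' j' : Fin 4) :
    Tendsto (fun β : ℝ =>
      wilsonExpectation (d := 4) (L := L) r.ρ β (fun U =>
          ((r.N : ℝ) - (r.ρ (plaquetteHolonomy U x i j)).trace.re) *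
            ((r.N : ℝ) - (r.ρ (plaquetteHolonomy U y i' j')).trace.re)) -
        wilsonExpectation (d := 4) (L := L) r.ρ β
            (fun U => (r.N : ℝ) - (r.ρ (plaquetteHolonomy U x i j)).trace.re) *
          wilsonExpectation (d := 4) (L := L) r.ρ β
            (fun U => (r.N : ℝ) - (r.ρ (plaquetteHolonomy U y i' j')).trace.re)) atTop (𝓝 0) := by
  haveI : SecondCountableTopology G := secondCountable_of_latticeRep r
  exact tendsto_plaquetteCov r.ρ r.continuous r.mem_unitary x y i j i' j'

end Summit.QuantumFields.YangMills.Theorems.FemtoCurvatureTwoPoint.Negative.PlaquetteFreezing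

end
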